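/-
Copyright (c) 2026. All rights reserved.
Released under Apache 2.0 license as described in the file LICENSE.
Authors: abc-iut cell, prover seat abc-iut-E-t42 (gen 7).
-/
import Mathlib.NumberTheory.NumberField.Discriminant.Basic
import HarnessLib

/-!
# Minkowski's ℓ¹ (octahedral) body: a non-zero ideal element with small SUM OF CONJUGATES

Classical geometry of numbers (nothing disputed; no definition, no `Prop` fact, no instance).  Mathlib's
`NumberField.mixedEmbedding.exists_ne_zero_mem_ideal_of_norm_le` applies Minkowski's convex-body theorem to the body
`convexBodySum K B = {x | ∑_w mult(w)·‖x_w‖ ≤ B}` and then discards the linear information, keeping only the AM–GM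
consequence `|N(a)| ≤ (B/n)^n`.  THIS FILE keeps the linear form:

* `exists_ne_zero_mem_ideal_sum_mult_le` — if `minkowskiBound K I ≤ vol(convexBodySum K B)` then some `a ∈ I`, `a ≠ 0`
  has `∑_w mult(w)·w(a) ≤ B` (the sum over the infinite places with multiplicity = the sum of the absolute values of ALL
  `n` complex conjugates of `a`);
* `toReal_minkowskiBound_mul_inv_convexBodySumFactor` — the optimal `B`: `B^n = N(I)·(4/π)^{r₂}·n!·√|d_K|`
  (Mathlib's own computation, exposed);
* **`exists_ne_zero_mem_ideal_sum_mult_pow_le`** — hence some `a ∈ I ∖ 0` with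
  `(∑_w mult(w)·w(a))^n ≤ N(I)·(4/π)^{r₂}·n!·√|d_K|`, and the integral-ideal / ring-of-integers forms
  `exists_ne_zero_mem_sum_mult_pow_le_of_ideal`, `exists_ne_zero_sum_mult_pow_le`;
* `sum_norm_embeddings_eq_sum_mult` — `∑_{σ : K →+* ℂ} ‖σ a‖ = ∑_w mult(w)·w(a)`, and the embedding forms of the above.

This is Hunter's / Pohst's starting point for enumerating number fields of small discriminant: the conjugate vector of
`a` lies in an explicit octahedron, so the characteristic polynomial of `a` lies in an explicit finite box.
[cite: EsmondeMurty1999, Ex. 6.5.12 and Ex. 6.5.21 p. 93]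
-/

namespace Literature.NumberTheory.NumberFields

open NumberField NumberField.InfinitePlace NumberField.mixedEmbedding Module MeasureTheory Real
open scoped nonZeroDivisors ENNReal

variable (K : Type*) [Field K] [NumberField K]

open scoped Classical in
/-- **Minkowski on the ℓ¹ body, linear form kept**: if the Minkowski bound of the ideal lattice of `I` is at most the
volume of `convexBodySum K B`, some non-zero `a ∈ I` has `∑_w mult(w)·w(a) ≤ B`.  (Mathlib's
`exists_ne_zero_mem_ideal_of_norm_le` is this followed by AM–GM.) [cite: EsmondeMurty1999, Ex. 6.5.12 and Ex. 6.5.21 p. 93] -/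
theorem exists_ne_zero_mem_ideal_sum_mult_le (I : (FractionalIdeal (𝓞 K)⁰ K)ˣ) {B : ℝ}
    (h : minkowskiBound K I ≤ volume (convexBodySum K B)) :
    ∃ a ∈ (I : FractionalIdeal (𝓞 K)⁰ K), a ≠ 0 ∧
      ∑ w : InfinitePlace K, (mult w : ℝ) * w a ≤ B := by
  classical
  have h_fund := ZSpan.isAddFundamentalDomain' (fractionalIdealLatticeBasis K I) volume
  have : Countable (Submodule.span ℤ (Set.range (fractionalIdealLatticeBasis K I))).toAddSubgroup := by
    change Countable (Submodule.span ℤ (Set.range (fractionalIdealLatticeBasis K I)))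
    infer_instance
  obtain ⟨⟨x, hx⟩, h_nz, h_mem⟩ := exists_ne_zero_mem_lattice_of_measure_mul_two_pow_le_measure
      h_fund (fun _ ↦ convexBodySum_neg_mem K B) (convexBodySum_convex K B)
      (convexBodySum_compact K B) h
  rw [Submodule.mem_toAddSubgroup, mem_span_fractionalIdealLatticeBasis] at hx
  obtain ⟨a, ha, rfl⟩ := hx
  exact ⟨a, ha, by simpa using h_nz, (convexBodySum_mem K B).mp h_mem⟩

open scoped Classical in
/-- Mathlib's computation of the optimal radius, exposed: `(minkowskiBound K I / convexBodySumFactor K).toReal =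
N(I) · (4/π)^{r₂} · n! · √|d_K|`. [cite: EsmondeMurty1999, Ex. 6.5.12 and Ex. 6.5.21 p. 93] -/
theorem toReal_minkowskiBound_mul_inv_convexBodySumFactor (I : (FractionalIdeal (𝓞 K)⁰ K)ˣ) :
    (minkowskiBound K I * (convexBodySumFactor K)⁻¹).toReal =
      FractionalIdeal.absNorm I.1 * (4 / π) ^ nrComplexPlaces K * (finrank ℚ K).factorial *
        Real.sqrt |discr K| := by
  classical
  calc
    _ = FractionalIdeal.absNorm I.1 * (2 : ℝ)⁻¹ ^ nrComplexPlaces K * (NNReal.sqrt ‖discr K‖₊ : ℝ) *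
          (2 : ℝ) ^ finrank ℚ K * ((2 : ℝ) ^ nrRealPlaces K * (π / 2) ^ nrComplexPlaces K /
            (Nat.factorial (finrank ℚ K)))⁻¹ := by
      simp_rw [minkowskiBound, convexBodySumFactor,
        volume_fundamentalDomain_fractionalIdealLatticeBasis,
        volume_fundamentalDomain_latticeBasis, ENNReal.toReal_mul, ENNReal.toReal_pow, ENNReal.toReal_inv,
        ENNReal.coe_toReal, ENNReal.toReal_ofNat, mixedEmbedding.finrank, mul_assoc]
      rw [ENNReal.toReal_ofReal (Rat.cast_nonneg.mpr (FractionalIdeal.absNorm_nonneg I.1))]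
      simp_rw [NNReal.coe_inv, NNReal.coe_div, NNReal.coe_mul, NNReal.coe_pow, NNReal.coe_div,
        NNReal.coe_real_pi, NNReal.coe_ofNat, NNReal.coe_natCast]
    _ = FractionalIdeal.absNorm I.1 * (2 : ℝ) ^ (finrank ℚ K - nrComplexPlaces K - nrRealPlaces K +
          nrComplexPlaces K : ℤ) * Real.sqrt ‖discr K‖ * Nat.factorial (finrank ℚ K) *
            π⁻¹ ^ (nrComplexPlaces K) := by
      simp_rw [inv_div, div_eq_mul_inv, mul_inv, ← zpow_neg_one, ← zpow_natCast, mul_zpow,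
        ← zpow_mul, neg_one_mul, mul_neg_one, neg_neg, Real.coe_sqrt, coe_nnnorm, sub_eq_add_neg,
        zpow_add₀ (two_ne_zero : (2 : ℝ) ≠ 0)]
      ring
    _ = FractionalIdeal.absNorm I.1 * (2 : ℝ) ^ (2 * nrComplexPlaces K : ℤ) * Real.sqrt ‖discr K‖ *
          Nat.factorial (finrank ℚ K) * π⁻¹ ^ (nrComplexPlaces K) := by
      congr
      rw [← card_add_two_mul_card_eq_rank, Nat.cast_add, Nat.cast_mul, Nat.cast_ofNat]
      ring
    _ = FractionalIdeal.absNorm I.1 * (4 / π) ^ nrComplexPlaces K * (finrank ℚ K).factorial *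
          Real.sqrt |discr K| := by
      rw [Int.norm_eq_abs, zpow_mul, show (2 : ℝ) ^ (2 : ℤ) = 4 by norm_cast, div_pow,
        inv_eq_one_div, div_pow, one_pow, zpow_natCast]
      ring

/-- **Minkowski's ℓ¹ theorem for an ideal lattice**: some non-zero `a ∈ I` has
`(∑_w mult(w)·w(a))^n ≤ N(I)·(4/π)^{r₂}·n!·√|d_K|` (`n = [K:ℚ]`, `r₂` the number of complex places).
[cite: EsmondeMurty1999, Ex. 6.5.12 and Ex. 6.5.21 p. 93] -/
theorem exists_ne_zero_mem_ideal_sum_mult_pow_le (I : (FractionalIdeal (𝓞 K)⁰ K)ˣ) :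
    ∃ a ∈ (I : FractionalIdeal (𝓞 K)⁰ K), a ≠ 0 ∧
      (∑ w : InfinitePlace K, (mult w : ℝ) * w a) ^ finrank ℚ K ≤
        FractionalIdeal.absNorm I.1 * (4 / π) ^ nrComplexPlaces K * (finrank ℚ K).factorial *
          Real.sqrt |discr K| := by
  classical
  let B := (minkowskiBound K I * (convexBodySumFactor K)⁻¹).toReal ^ (1 / (finrank ℚ K : ℝ))
  have hB0 : 0 ≤ (minkowskiBound K I * (convexBodySumFactor K)⁻¹).toReal := ENNReal.toReal_nonneg
  have h_le : (minkowskiBound K I) ≤ volume (convexBodySum K B) := by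
    refine le_of_eq ?_
    rw [convexBodySum_volume, ← ENNReal.ofReal_pow (by positivity), ← Real.rpow_natCast,
      ← Real.rpow_mul ENNReal.toReal_nonneg, div_mul_cancel₀, Real.rpow_one, ENNReal.ofReal_toReal, mul_comm,
      mul_assoc, ← ENNReal.coe_mul, inv_mul_cancel₀ (convexBodySumFactor_ne_zero K), ENNReal.coe_one,
      mul_one]
    · exact ENNReal.mul_ne_top (ne_of_lt (minkowskiBound_lt_top K I)) ENNReal.coe_ne_top
    · exact (Nat.cast_ne_zero.mpr (ne_of_gt finrank_pos))
  obtain ⟨a, ha, hne, hsum⟩ := exists_ne_zero_mem_ideal_sum_mult_le K I h_le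
  refine ⟨a, ha, hne, ?_⟩
  have hS0 : 0 ≤ ∑ w : InfinitePlace K, (mult w : ℝ) * w a :=
    Finset.sum_nonneg fun w _ => mul_nonneg (Nat.cast_nonneg _) (apply_nonneg _ _)
  have hBn : B ^ finrank ℚ K = (minkowskiBound K I * (convexBodySumFactor K)⁻¹).toReal := by
    simp only [B]
    rw [← Real.rpow_natCast, ← Real.rpow_mul hB0, one_div_mul_cancel
      (Nat.cast_ne_zero.mpr (ne_of_gt finrank_pos)), Real.rpow_one]
  rw [← toReal_minkowskiBound_mul_inv_convexBodySumFactor, ← hBn]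
  exact pow_le_pow_left₀ hS0 hsum _

/-- The same for an INTEGRAL ideal `J ≠ ⊥` of `𝓞 K`: some `a ∈ J`, `a ≠ 0`, with
`(∑_w mult(w)·w(a))^n ≤ N(J)·(4/π)^{r₂}·n!·√|d_K|`. [cite: EsmondeMurty1999, Ex. 6.5.12 and Ex. 6.5.21 p. 93] -/
theorem exists_ne_zero_mem_sum_mult_pow_le_of_ideal (J : Ideal (𝓞 K)) (hJ : J ≠ ⊥) :
    ∃ a : 𝓞 K, a ∈ J ∧ a ≠ 0 ∧
      (∑ w : InfinitePlace K, (mult w : ℝ) * w (a : K)) ^ finrank ℚ K ≤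
        (Ideal.absNorm J : ℝ) * (4 / π) ^ nrComplexPlaces K * (finrank ℚ K).factorial *
          Real.sqrt |discr K| := by
  classical
  have hJ0 : (J : FractionalIdeal (𝓞 K)⁰ K) ≠ 0 := by
    rwa [Ne, FractionalIdeal.coeIdeal_eq_zero]
  let I : (FractionalIdeal (𝓞 K)⁰ K)ˣ := Units.mk0 (J : FractionalIdeal (𝓞 K)⁰ K) hJ0
  obtain ⟨x, hx, hne, hle⟩ := exists_ne_zero_mem_ideal_sum_mult_pow_le K I
  have hx' : x ∈ (J : FractionalIdeal (𝓞 K)⁰ K) := hx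
  rw [FractionalIdeal.mem_coeIdeal] at hx'
  obtain ⟨a, haJ, rfl⟩ := hx'
  refine ⟨a, haJ, fun h => hne (by simp [h]), ?_⟩
  have hN : FractionalIdeal.absNorm I.1 = (Ideal.absNorm J : ℚ) := by
    simp [I, FractionalIdeal.coeIdeal_absNorm]
  simpa [hN] using hle

/-- The ring-of-integers form (`J = 𝓞 K`): some `a ≠ 0` in `𝓞 K` with `(∑_w mult(w)·w(a))^n ≤ (4/π)^{r₂}·n!·√|d_K|`.
[cite: EsmondeMurty1999, Ex. 6.5.12 and Ex. 6.5.21 p. 93] -/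
theorem exists_ne_zero_sum_mult_pow_le :
    ∃ a : 𝓞 K, a ≠ 0 ∧
      (∑ w : InfinitePlace K, (mult w : ℝ) * w (a : K)) ^ finrank ℚ K ≤
        (4 / π) ^ nrComplexPlaces K * (finrank ℚ K).factorial * Real.sqrt |discr K| := by
  obtain ⟨a, -, hne, hle⟩ := exists_ne_zero_mem_sum_mult_pow_le_of_ideal K ⊤ (by simp)
  refine ⟨a, hne, ?_⟩
  simpa using hle

/-! ## The sum over the complex embeddings -/

/-- `∑_{σ : K →+* ℂ} ‖σ a‖ = ∑_w mult(w)·w(a)`: the embedding sum is the place sum with multiplicities.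
[cite: EsmondeMurty1999, Ex. 6.5.12 and Ex. 6.5.21 p. 93] -/
theorem sum_norm_embeddings_eq_sum_mult (a : K) :
    ∑ σ : K →+* ℂ, ‖σ a‖ = ∑ w : InfinitePlace K, (mult w : ℝ) * w a := by
  classical
  rw [← Finset.sum_fiberwise_of_maps_to (g := InfinitePlace.mk) (fun σ _ => Finset.mem_univ (InfinitePlace.mk σ))]
  refine Finset.sum_congr rfl fun w _ => ?_
  have : ∀ σ ∈ Finset.univ.filter (fun σ : K →+* ℂ => InfinitePlace.mk σ = w), ‖σ a‖ = w a := by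
    intro σ hσ
    rw [Finset.mem_filter] at hσ
    rw [← hσ.2, InfinitePlace.apply]
  rw [Finset.sum_congr rfl this, Finset.sum_const, nsmul_eq_mul, InfinitePlace.card_filter_mk_eq]

/-- `∑_{σ} ‖σ a‖^k = ∑_w mult(w)·w(a)^k` for every exponent `k`. [cite: EsmondeMurty1999, Ex. 6.5.12 and Ex. 6.5.21 p. 93] -/
theorem sum_norm_embeddings_pow_eq_sum_mult (a : K) (k : ℕ) :
    ∑ σ : K →+* ℂ, ‖σ a‖ ^ k = ∑ w : InfinitePlace K, (mult w : ℝ) * w a ^ k := by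
  classical
  rw [← Finset.sum_fiberwise_of_maps_to (g := InfinitePlace.mk) (fun σ _ => Finset.mem_univ (InfinitePlace.mk σ))]
  refine Finset.sum_congr rfl fun w _ => ?_
  have : ∀ σ ∈ Finset.univ.filter (fun σ : K →+* ℂ => InfinitePlace.mk σ = w), ‖σ a‖ ^ k = w a ^ k := by
    intro σ hσ
    rw [Finset.mem_filter] at hσ
    rw [← hσ.2, InfinitePlace.apply]
  rw [Finset.sum_congr rfl this, Finset.sum_const, nsmul_eq_mul, InfinitePlace.card_filter_mk_eq]

/-- `∏_{σ : K →+* ℂ} ‖σ a‖ = |N_{K/ℚ}(a)|`. [cite: EsmondeMurty1999, Ex. 6.5.12 and Ex. 6.5.21 p. 93] -/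
theorem prod_norm_embeddings_eq_abs_norm (a : K) :
    ∏ σ : K →+* ℂ, ‖σ a‖ = |(Algebra.norm ℚ a : ℝ)| := by
  have h := Algebra.norm_eq_prod_embeddings ℚ ℂ a
  have h2 : ‖(algebraMap ℚ ℂ) (Algebra.norm ℚ a)‖ = ∏ σ : K →ₐ[ℚ] ℂ, ‖σ a‖ := by
    rw [h, norm_prod]
  rw [Fintype.prod_equiv RingHom.equivRatAlgHom (fun σ : K →+* ℂ => ‖σ a‖) (fun σ : K →ₐ[ℚ] ℂ => ‖σ a‖)
    (fun σ => rfl), ← h2]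
  simp [Complex.norm_ratCast]

/-- **Embedding form of the ℓ¹ Minkowski theorem** for an integral ideal `J ≠ ⊥`: some `a ∈ J ∖ 0` with
`(∑_σ ‖σ a‖)^n ≤ N(J)·(4/π)^{r₂}·n!·√|d_K|`. [cite: EsmondeMurty1999, Ex. 6.5.12 and Ex. 6.5.21 p. 93] -/
theorem exists_ne_zero_mem_sum_embeddings_pow_le_of_ideal (J : Ideal (𝓞 K)) (hJ : J ≠ ⊥) :
    ∃ a : 𝓞 K, a ∈ J ∧ a ≠ 0 ∧
      (∑ σ : K →+* ℂ, ‖σ (a : K)‖) ^ finrank ℚ K ≤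
        (Ideal.absNorm J : ℝ) * (4 / π) ^ nrComplexPlaces K * (finrank ℚ K).factorial *
          Real.sqrt |discr K| := by
  obtain ⟨a, haJ, hne, hle⟩ := exists_ne_zero_mem_sum_mult_pow_le_of_ideal K J hJ
  exact ⟨a, haJ, hne, by rwa [sum_norm_embeddings_eq_sum_mult]⟩

/-- A crude but signature-free corollary: `(∑_σ ‖σ a‖)^n ≤ N(J)·(4/π)^{⌊n/2⌋}·n!·√|d_K|` (`r₂ ≤ ⌊n/2⌋` and `4/π ≥ 1`).
[cite: EsmondeMurty1999, Ex. 6.5.12 and Ex. 6.5.21 p. 93] -/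
theorem exists_ne_zero_mem_sum_embeddings_pow_le_of_ideal' (J : Ideal (𝓞 K)) (hJ : J ≠ ⊥) :
    ∃ a : 𝓞 K, a ∈ J ∧ a ≠ 0 ∧
      (∑ σ : K →+* ℂ, ‖σ (a : K)‖) ^ finrank ℚ K ≤
        (Ideal.absNorm J : ℝ) * (4 / π) ^ (finrank ℚ K / 2) * (finrank ℚ K).factorial *
          Real.sqrt |discr K| := by
  obtain ⟨a, haJ, hne, hle⟩ := exists_ne_zero_mem_sum_embeddings_pow_le_of_ideal K J hJ
  refine ⟨a, haJ, hne, hle.trans ?_⟩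
  have h1 : (1 : ℝ) ≤ 4 / π := by
    rw [le_div_iff₀ Real.pi_pos, one_mul]; exact Real.pi_lt_four.le
  have hr : nrComplexPlaces K ≤ finrank ℚ K / 2 := by
    have := card_add_two_mul_card_eq_rank K
    omega
  gcongr

end Literature.NumberTheory.NumberFields
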